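import Mathlib
import Summits.HodgeConjecture.HodgeConjecture.Theorems.HodgeLocusCensusUnitColumnRankD4
import Summits.HodgeConjecture.HodgeConjecture.Theorems.HodgeLocusCensusInclusionPowers

/-!
# THEOREM L at `d = 4`, `c′ = 1`, EVERY level: `rank (×q : B_{2k−j−2} → B_{2k−j}) = Σ_s C(k,s)·min (C(k−s,(j−s)/2), C(k−s,(j−s)/2+1))`
(`s ≤ j`, `j − s` even; characteristic `0`) — ENGINE B gen 50 PROBE 4 (successor material O-113; not an item)

certified instances and evidence bearing on the general Hodge conjecture; no claim.

Setting: `B = K[x₁,…,x_k]/(xᵢ³)`, `q = Σ xᵢ²` (THEOREM K-MODEL, `d = 4`), anchor 174's index convention: rows = exponent functions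
`v : Fin k → Fin 3` of codegree `j` (`Σ v + j = 2k`, the target `B_{2k−j}`), columns `m` of codegree `j + 2` (the source `B_{2k−j−2}`), entry
`[List.ofFn v ∈ colR 4 (List.ofFn m)]` (gen 31's column-support function `colR`; = the coefficient, anchor 174's `indicator_eq_count_colR`).
Anchor 174 proved the ONE level `×q : B_{2k−4} → B_{2k−2}` (`rank_mulDelta_modelC1_d4`, `(2 : K) ≠ 0`) and anchor 191 its characteristic-2 deficit.
THIS FILE: every level at once, in characteristic `0`:
  `rank = Σ_{s = 0}^{k} C(k,s) · [s ≤ j, j − s even] · min (C(k−s, (j−s)/2), C(k−s, (j−s)/2 + 1))`      (`rank_mulDelta_d4_levels`).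
MECHANISM (THEOREM L, record `pub-hlocus-ivhs-2/gen50/ENGINEB-g50.md` §2–§3): a coordinate with exponent `1` is a SPECTATOR — `×xᵢ²` kills it and no
product creates it — so the matrix is a direct sum over the spectator set `S = {l : v l = 1}` (`spec_eq_of_mem_colR`); the block of `S` (`|S| = s`,
`j − s = 2t`) is, in the zero sets `Z(v) ⊆ {x ∉ S}` (`|Z(v)| = t`, `|Z(m)| = t + 1`; `mem_colR_iff_zeros`, `exists_fiberEquiv`), the set-inclusion
matrix `W^{(1)}_t` of the `(k − s)`-set `{x : Fin k // x ∉ S}`, whose rank `min (C(k−s,t), C(k−s,t+1))` is ENGINE B's anchor 204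
(`HodgeLocusCensusInclusionPowers.rank_incl_pow`, Gottlieb–Kantor in characteristic 0, APPLIED BY NAME with `c = 1`); blocks with `s > j` or `j − s`
odd have no rows (`rank_fiber_zero`, by the mass identity `Σ v + 2·#zeros + #ones = 2k`, `sum_add_levels`).  The direct-sum step is the general
BLOCK ENGINE proved here over an arbitrary field (PROBE 4a): `rank_blockDiagonal'` for RECTANGULAR dependent blocks and `rank_eq_sum_rank_fiber(_of)`
(rows/columns labelled, cross-label entries zero ⇒ `rank = Σ_labels rank (fibre block)`), reindexing along `Equiv.sigmaFiberEquiv`; the regrouping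
`Σ_{S} G(|S|) = Σ_s C(k,s)·G(s)` is Mathlib's `Finset.sum_powerset_apply_card`.
Imports `Mathlib`, anchor 174 (`ofFn_mem_colR_iff`, `sum_levels`; `colR` through it) and anchor 204 (`rank_incl_pow`) BY NAME; nothing restated.
Theorem-only, definition-free, no `decide`; characteristic `0` enters only through anchor 204.  Numerics: `gen50/check/d4levels.py` (direct exact ranks
over ℚ = this closed form, `k ≤ 6`, every `j`; also `c = 2, 3` with `t + c` in place of `t + 1` — the `×q^c` every-level statement needs the
`flatMap`-multiplicity entry as in PROBE 3 and is left to a successor).  Evidence-class material; no census number changes; nothing about HC.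
-/

set_option linter.dupNamespace false
set_option autoImplicit false

namespace Summit.HodgeConjecture.HodgeConjecture.HodgeLocus.Census.UnitColumnRankD4Levels

open Summit.HodgeConjecture.HodgeConjecture.HodgeLocus.Census.ModelNonJumpC1All (colR)
open Summit.HodgeConjecture.HodgeConjecture.HodgeLocus.Census.UnitColumnRankD4 (ofFn_mem_colR_iff sum_levels)
open Summit.HodgeConjecture.HodgeConjecture.HodgeLocus.Census.InclusionPowers (rank_incl_pow)
open Matrix Module

/-! ## Block engine: rank of a direct sum of rectangular blocks; rank of a label-respecting matrix -/

section Blocks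

variable {K : Type*} [Field K] {ι : Type*} [DecidableEq ι] {m' n' : ι → Type*}

/-- `(⊕ Nᵢ) v` on the `i`-th block of row coordinates is `Nᵢ vᵢ` (rectangular blocks). -/
theorem blockDiagonal'_mulVec_apply [Fintype ι] [∀ i, Fintype (n' i)] (N : ∀ i, Matrix (m' i) (n' i) K)
    (v : (Σ i, n' i) → K) (i : ι) (a : m' i) :
    (blockDiagonal' N).mulVec v ⟨i, a⟩ = (N i).mulVec (fun b => v ⟨i, b⟩) a := by
  simp only [Matrix.mulVec, dotProduct]
  rw [← Finset.univ_sigma_univ, Finset.sum_sigma, Finset.sum_eq_single i]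
  · simp only [blockDiagonal'_apply_eq]
  · intro i' _ hi'
    apply Finset.sum_eq_zero
    intro b _
    rw [blockDiagonal'_apply_ne _ _ _ (Ne.symm hi'), zero_mul]
  · intro h; exact absurd (Finset.mem_univ i) h

/-- rank of a direct sum of RECTANGULAR blocks: `rank (blockDiagonal' N) = Σᵢ rank (N i)` -/
theorem rank_blockDiagonal' [Fintype ι] [∀ i, Fintype (m' i)] [∀ i, Fintype (n' i)] [∀ i, DecidableEq (n' i)]
    (N : ∀ i, Matrix (m' i) (n' i) K) :
    (blockDiagonal' N).rank = ∑ i, (N i).rank := by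
  let eS := LinearEquiv.piCurry K (fun (i : ι) (_ : n' i) => K)
  let eT := LinearEquiv.piCurry K (fun (i : ι) (_ : m' i) => K)
  let F : ∀ i, (n' i → K) →ₗ[K] (m' i → K) := fun i => (N i).mulVecLin
  have hcomm : (eT : ((Σ i, m' i) → K) →ₗ[K] (Π i, m' i → K)) ∘ₗ (blockDiagonal' N).mulVecLin =
      (LinearMap.piMap F) ∘ₗ (eS : ((Σ i, n' i) → K) →ₗ[K] (Π i, n' i → K)) := by
    refine LinearMap.ext fun v => funext fun i => funext fun a => ?_
    change (blockDiagonal' N).mulVec v ⟨i, a⟩ = (N i).mulVec (fun b => v ⟨i, b⟩) a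
    exact blockDiagonal'_mulVec_apply N v i a
  have hr : LinearMap.range (LinearMap.piMap F) =
      Submodule.pi Set.univ (fun i => LinearMap.range (F i)) := by
    ext x
    simp only [LinearMap.mem_range, Submodule.mem_pi, Set.mem_univ, true_implies]
    constructor
    · rintro ⟨y, rfl⟩ i
      exact ⟨y i, rfl⟩
    · intro h
      choose y hy using h
      exact ⟨y, funext hy⟩
  have hpi : finrank K (Submodule.pi Set.univ (fun i => LinearMap.range (F i))) = ∑ i, (N i).rank := by
    let f : (Submodule.pi Set.univ (fun i => LinearMap.range (F i))) ≃ₗ[K]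
        (Π i, LinearMap.range (F i)) :=
      { toFun := fun x i => ⟨x.1 i, x.2 i trivial⟩
        map_add' := fun _ _ => rfl
        map_smul' := fun _ _ => rfl
        invFun := fun y => ⟨fun i => (y i).1, fun i _ => (y i).2⟩
        left_inv := fun _ => rfl
        right_inv := fun _ => rfl }
    rw [f.finrank_eq, Module.finrank_pi_fintype]
    rfl
  show finrank K (LinearMap.range (blockDiagonal' N).mulVecLin) = _
  rw [← eT.finrank_map_eq, ← LinearMap.range_comp, hcomm, LinearMap.range_comp_of_range_eq_top _ eS.range,
    hr, hpi]

variable {m n : Type*}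

/-- reindexing a label-respecting matrix along the fibre decompositions of the labels gives the direct sum of its label blocks -/
theorem reindex_sigmaFiber_eq_blockDiagonal' (A : Matrix m n K) (lr : m → ι) (lc : n → ι)
    (h : ∀ r c, lr r ≠ lc c → A r c = 0) :
    Matrix.reindex (Equiv.sigmaFiberEquiv lr).symm (Equiv.sigmaFiberEquiv lc).symm A =
      blockDiagonal' (fun i => A.submatrix (Subtype.val : {r // lr r = i} → m) (Subtype.val : {c // lc c = i} → n)) := by
  ext ⟨i, r⟩ ⟨i', c⟩
  simp only [Matrix.reindex_apply, Equiv.symm_symm, Matrix.submatrix_apply, Equiv.sigmaFiberEquiv_apply]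
  by_cases hii : i = i'
  · subst hii
    rw [blockDiagonal'_apply_eq, Matrix.submatrix_apply]
  · rw [blockDiagonal'_apply_ne _ _ _ hii]
    exact h r.1 c.1 (fun hh => hii (r.2.symm.trans (hh.trans c.2)))

/-- **rank of a label-respecting matrix = sum over the labels of the ranks of its fibre blocks** -/
theorem rank_eq_sum_rank_fiber [Fintype ι] [Fintype m] [Fintype n] [DecidableEq n] (A : Matrix m n K) (lr : m → ι) (lc : n → ι)
    (h : ∀ r c, lr r ≠ lc c → A r c = 0) :
    A.rank = ∑ i, (A.submatrix (Subtype.val : {r // lr r = i} → m) (Subtype.val : {c // lc c = i} → n)).rank := by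
  rw [← Matrix.rank_reindex (Equiv.sigmaFiberEquiv lr).symm (Equiv.sigmaFiberEquiv lc).symm A,
    reindex_sigmaFiber_eq_blockDiagonal' A lr lc h, rank_blockDiagonal']

/-- the same with the blocks written as `Matrix.of` over the fibre subtypes -/
theorem rank_eq_sum_rank_fiber_of [Fintype ι] [Fintype m] [Fintype n] [DecidableEq n] (f : m → n → K) (lr : m → ι) (lc : n → ι)
    (h : ∀ r c, lr r ≠ lc c → f r c = 0) :
    (Matrix.of f).rank = ∑ i, (Matrix.of fun (r : {r // lr r = i}) (c : {c // lc c = i}) => f r.1 c.1).rank := by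
  rw [rank_eq_sum_rank_fiber (Matrix.of f) lr lc (fun r c hrc => by rw [Matrix.of_apply]; exact h r c hrc)]
  rfl

end Blocks

/-! ## `d = 4` exponent functions `Fin k → Fin 3`: mass, spectators (exponent `1`), zeros -/

/-- an exponent is `0`, `1` or `2` -/
theorem val_cases {k : ℕ} (v : Fin k → Fin 3) (l : Fin k) : (v l : ℕ) = 0 ∨ (v l : ℕ) = 1 ∨ (v l : ℕ) = 2 := by
  have := (v l).isLt; omega

/-- mass in terms of levels: `Σ v + 2·#{v = 0} + #{v = 1} = 2k` -/
theorem sum_add_levels {k : ℕ} (v : Fin k → Fin 3) :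
    (∑ l, (v l : ℕ)) + 2 * (Finset.univ.filter (fun l => (v l : ℕ) = 0)).card
      + (Finset.univ.filter (fun l => (v l : ℕ) = 1)).card = k * 2 := by
  have h2 : ∀ l : Fin k, (v l : ℕ) + (2 * (if (v l : ℕ) = 0 then 1 else 0) + (if (v l : ℕ) = 1 then 1 else 0)) = 2 :=
    fun l => by rcases val_cases v l with h | h | h <;> simp [h]
  have h3 := Finset.sum_congr rfl (fun l (_ : l ∈ (Finset.univ : Finset (Fin k))) => h2 l)
  rw [Finset.sum_add_distrib, Finset.sum_add_distrib, ← Finset.mul_sum, ← Finset.card_filter, ← Finset.card_filter] at h3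
  simp only [Finset.sum_const, smul_eq_mul, Finset.card_univ, Fintype.card_fin] at h3
  omega

/-- SPECTATORS ARE PRESERVED: if `x^v` occurs in `q·x^m` then `v` and `m` have the same exponent-`1` set -/
theorem spec_eq_of_mem_colR {k : ℕ} (m v : Fin k → Fin 3)
    (h : List.ofFn (fun l => (v l : ℕ)) ∈ colR 4 (List.ofFn (fun l => (m l : ℕ)))) :
    Finset.univ.filter (fun l => (v l : ℕ) = 1) = Finset.univ.filter (fun l => (m l : ℕ) = 1) := by
  obtain ⟨i, hm0, hv2, hoff⟩ := (ofFn_mem_colR_iff (d := 4) m v).mp h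
  ext l
  simp only [Finset.mem_filter, Finset.mem_univ, true_and]
  by_cases hl : l = i
  · subst hl; constructor <;> intro h' <;> omega
  · rw [hoff l hl]

/-- the entry in zero sets: for `v`, `m` with the same spectators, `x^v` occurs in `q·x^m` iff `Z(v) ⊆ Z(m)` and `|Z(m)| = |Z(v)| + 1` -/
theorem mem_colR_iff_zeros {k : ℕ} (m v : Fin k → Fin 3)
    (hspec : Finset.univ.filter (fun l => (v l : ℕ) = 1) = Finset.univ.filter (fun l => (m l : ℕ) = 1)) :
    List.ofFn (fun l => (v l : ℕ)) ∈ colR 4 (List.ofFn (fun l => (m l : ℕ))) ↔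
      (Finset.univ.filter (fun l => (v l : ℕ) = 0) ⊆ Finset.univ.filter (fun l => (m l : ℕ) = 0) ∧
        (Finset.univ.filter (fun l => (m l : ℕ) = 0)).card = (Finset.univ.filter (fun l => (v l : ℕ) = 0)).card + 1) := by
  have hs : ∀ l, (v l : ℕ) = 1 ↔ (m l : ℕ) = 1 := fun l => by
    have e := congrArg (fun s : Finset (Fin k) => l ∈ s) hspec
    simpa using e
  rw [ofFn_mem_colR_iff (d := 4) m v]
  constructor
  · rintro ⟨i, hm0, hv2, hoff⟩
    have hni : i ∉ Finset.univ.filter (fun l => (v l : ℕ) = 0) := by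
      simp only [Finset.mem_filter, Finset.mem_univ, true_and]; omega
    have hZ : Finset.univ.filter (fun l => (m l : ℕ) = 0) = insert i (Finset.univ.filter (fun l => (v l : ℕ) = 0)) := by
      ext l
      simp only [Finset.mem_filter, Finset.mem_univ, true_and, Finset.mem_insert]
      by_cases hl : l = i
      · subst hl
        exact ⟨fun _ => Or.inl rfl, fun _ => hm0⟩
      · rw [hoff l hl]
        exact ⟨fun h' => Or.inr h', fun h' => h'.resolve_left hl⟩
    refine ⟨?_, ?_⟩
    · rw [hZ]; exact Finset.subset_insert _ _
    · rw [hZ, Finset.card_insert_of_notMem hni]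
  · rintro ⟨hsub, hcard⟩
    have hne : Finset.univ.filter (fun l => (v l : ℕ) = 0) ≠ Finset.univ.filter (fun l => (m l : ℕ) = 0) := fun h' => by
      rw [h'] at hcard; omega
    obtain ⟨i, hiM, hiV⟩ := Finset.exists_of_ssubset (Finset.ssubset_iff_subset_ne.mpr ⟨hsub, hne⟩)
    have hZ : Finset.univ.filter (fun l => (m l : ℕ) = 0) = insert i (Finset.univ.filter (fun l => (v l : ℕ) = 0)) := by
      symm
      apply Finset.eq_of_subset_of_card_le (Finset.insert_subset hiM hsub)
      rw [Finset.card_insert_of_notMem hiV]; omega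
    simp only [Finset.mem_filter, Finset.mem_univ, true_and] at hiM hiV
    refine ⟨i, hiM, ?_, fun l hl => ?_⟩
    · rcases val_cases v i with h' | h' | h'
      · exact absurd h' hiV
      · have := (hs i).mp h'; omega
      · omega
    · apply Fin.ext
      rcases val_cases v l with h' | h' | h'
      · have hl' : l ∈ Finset.univ.filter (fun l => (m l : ℕ) = 0) := hsub (by simpa using h')
        simp only [Finset.mem_filter, Finset.mem_univ, true_and] at hl'
        omega
      · have := (hs l).mp h'; omega
      · rcases val_cases m l with h'' | h'' | h''
        · have hl' : l ∈ Finset.univ.filter (fun l => (m l : ℕ) = 0) := by simpa using h''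
          rw [hZ, Finset.mem_insert] at hl'
          rcases hl' with hl' | hl'
          · exact absurd hl' hl
          · simp only [Finset.mem_filter, Finset.mem_univ, true_and] at hl'; omega
        · have := (hs l).mpr h''; omega
        · omega

/-- THE FIBRE OF A SPECTATOR SET `S` at codegree `a = 2z + |S|` is in bijection with the `z`-subsets of `{x // x ∉ S}` (the zero set), compatibly
with the zero-set map (stated as an existence so that the file stays definition-free) -/
theorem exists_fiberEquiv {k : ℕ} (S : Finset (Fin k)) (a z : ℕ) (haz : a = 2 * z + S.card) :
    ∃ e : ({r : {v : Fin k → Fin 3 // (∑ i, (v i : ℕ)) + a = k * 2} // Finset.univ.filter (fun l => (r.1 l : ℕ) = 1) = S} ≃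
           {Z : Finset {x : Fin k // x ∉ S} // Z.card = z}),
      ∀ r, ((e r).1).map (Function.Embedding.subtype (· ∉ S)) = Finset.univ.filter (fun l => (r.1.1 l : ℕ) = 0) := by
  have hZS : ∀ r : {r : {v : Fin k → Fin 3 // (∑ i, (v i : ℕ)) + a = k * 2} // Finset.univ.filter (fun l => (r.1 l : ℕ) = 1) = S},
      ∀ x ∈ Finset.univ.filter (fun l => (r.1.1 l : ℕ) = 0), x ∉ S := by
    intro r x hx hxS
    rw [← r.2] at hxS
    simp only [Finset.mem_filter, Finset.mem_univ, true_and] at hx hxS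
    omega
  have hcard : ∀ r : {r : {v : Fin k → Fin 3 // (∑ i, (v i : ℕ)) + a = k * 2} // Finset.univ.filter (fun l => (r.1 l : ℕ) = 1) = S},
      (Finset.univ.filter (fun l => (r.1.1 l : ℕ) = 0)).card = z := by
    intro r
    have h1 := sum_add_levels r.1.1
    rw [r.2] at h1
    have h2 := r.1.2
    omega
  have hdisj : ∀ Z : Finset {x : Fin k // x ∉ S}, Disjoint (Z.map (Function.Embedding.subtype (· ∉ S))) S := fun Z =>
    Finset.disjoint_left.mpr (fun x hx hxS => (Finset.property_of_mem_map_subtype Z hx) hxS)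
  have hlev : ∀ Z : {Z : Finset {x : Fin k // x ∉ S} // Z.card = z},
      (∑ l, ((if l ∈ Z.1.map (Function.Embedding.subtype (· ∉ S)) then (0 : Fin 3) else if l ∈ S then 1 else 2 : Fin 3) : ℕ))
        + a = k * 2 := by
    intro Z
    have h := sum_levels _ _ (hdisj Z.1)
    rw [Finset.card_map, Z.2] at h
    omega
  have hspec : ∀ Z : {Z : Finset {x : Fin k // x ∉ S} // Z.card = z},
      Finset.univ.filter (fun l => ((if l ∈ Z.1.map (Function.Embedding.subtype (· ∉ S)) then (0 : Fin 3)
        else if l ∈ S then 1 else 2 : Fin 3) : ℕ) = 1) = S := by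
    intro Z; ext l
    simp only [Finset.mem_filter, Finset.mem_univ, true_and]
    by_cases hZ : l ∈ Z.1.map (Function.Embedding.subtype (· ∉ S))
    · have hS : l ∉ S := Finset.disjoint_left.mp (hdisj Z.1) hZ
      simp [hZ, hS]
    · by_cases hS : l ∈ S <;> simp [hZ, hS]
  refine ⟨{ toFun := fun r => ⟨(Finset.univ.filter (fun l => (r.1.1 l : ℕ) = 0)).subtype (· ∉ S), by
              rw [← Finset.card_map (Function.Embedding.subtype (· ∉ S)), Finset.subtype_map_of_mem (hZS r), hcard r]⟩
            invFun := fun Z => ⟨⟨fun l => if l ∈ Z.1.map (Function.Embedding.subtype (· ∉ S)) then (0 : Fin 3)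
              else if l ∈ S then 1 else 2, hlev Z⟩, hspec Z⟩
            left_inv := fun r => ?_
            right_inv := fun Z => ?_ }, fun r => ?_⟩
  · apply Subtype.ext; apply Subtype.ext; funext l
    dsimp only
    rw [Finset.subtype_map_of_mem (hZS r)]
    have hs : (r.1.1 l : ℕ) = 1 ↔ l ∈ S := by
      have e := congrArg (fun s : Finset (Fin k) => l ∈ s) r.2
      simpa using e
    rcases val_cases r.1.1 l with h | h | h
    · have hl : l ∈ Finset.univ.filter (fun l => (r.1.1 l : ℕ) = 0) := by simpa using h
      rw [if_pos hl]; exact Fin.ext (by simp [h])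
    · have hl : l ∉ Finset.univ.filter (fun l => (r.1.1 l : ℕ) = 0) := by
        simp only [Finset.mem_filter, Finset.mem_univ, true_and]; omega
      rw [if_neg hl, if_pos (hs.mp h)]; exact Fin.ext (by simp [h])
    · have hl : l ∉ Finset.univ.filter (fun l => (r.1.1 l : ℕ) = 0) := by
        simp only [Finset.mem_filter, Finset.mem_univ, true_and]; omega
      have hS : l ∉ S := fun hS => by have := hs.mpr hS; omega
      rw [if_neg hl, if_neg hS]; exact Fin.ext (by simp [h])
  · apply Subtype.ext
    dsimp only
    ext ⟨x, hx⟩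
    simp only [Finset.mem_subtype, Finset.mem_filter, Finset.mem_univ, true_and]
    by_cases hZ : x ∈ Z.1.map (Function.Embedding.subtype (· ∉ S))
    · have hm : (⟨x, hx⟩ : {x : Fin k // x ∉ S}) ∈ Z.1 := by
        rw [Finset.mem_map] at hZ
        obtain ⟨y, hy, hyx⟩ := hZ
        have hy' : y = ⟨x, hx⟩ := Subtype.ext (by simpa using hyx)
        exact hy' ▸ hy
      simp [hZ, hm]
    · have hm : (⟨x, hx⟩ : {x : Fin k // x ∉ S}) ∉ Z.1 := fun h' => hZ (Finset.mem_map.mpr ⟨⟨x, hx⟩, h', rfl⟩)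
      simp [hZ, hx, hm]
  · exact Finset.subtype_map_of_mem (hZS r)

/-! ## Block ranks -/

/-- THE BLOCK OF A FEASIBLE SPECTATOR SET: `|S| = s`, `j = 2t + s` ⇒ the block is the set-inclusion matrix `W^{(1)}_t` of the `(k − s)`-set
`{x ∉ S}` up to reindexing; rank `min (C(k−s,t), C(k−s,t+1))` by anchor 204 (`rank_incl_pow`, characteristic `0`) -/
theorem rank_fiber (K : Type*) [Field K] [CharZero K] (k j : ℕ) (S : Finset (Fin k)) (t : ℕ) (hj : j = 2 * t + S.card) :
    (Matrix.of fun (r : {r : {v : Fin k → Fin 3 // (∑ i, (v i : ℕ)) + j = k * 2} // Finset.univ.filter (fun l => (r.1 l : ℕ) = 1) = S})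
        (c : {c : {m : Fin k → Fin 3 // (∑ i, (m i : ℕ)) + (j + 2) = k * 2} // Finset.univ.filter (fun l => (c.1 l : ℕ) = 1) = S}) =>
      if List.ofFn (fun i => (r.1.1 i : ℕ)) ∈ colR 4 (List.ofFn (fun i => (c.1.1 i : ℕ))) then (1 : K) else 0).rank =
      min ((k - S.card).choose t) ((k - S.card).choose (t + 1)) := by
  obtain ⟨eR, heR⟩ := exists_fiberEquiv S j t hj
  obtain ⟨eC, heC⟩ := exists_fiberEquiv S (j + 2) (t + 1) (by omega)
  have hα : Fintype.card {x : Fin k // x ∉ S} = k - S.card := by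
    rw [Fintype.card_subtype, show (Finset.univ.filter fun x => x ∉ S) = Sᶜ from by ext; simp, Finset.card_compl, Fintype.card_fin]
  have key : (Matrix.of fun (r : {r : {v : Fin k → Fin 3 // (∑ i, (v i : ℕ)) + j = k * 2} //
          Finset.univ.filter (fun l => (r.1 l : ℕ) = 1) = S})
        (c : {c : {m : Fin k → Fin 3 // (∑ i, (m i : ℕ)) + (j + 2) = k * 2} // Finset.univ.filter (fun l => (c.1 l : ℕ) = 1) = S}) =>
      if List.ofFn (fun i => (r.1.1 i : ℕ)) ∈ colR 4 (List.ofFn (fun i => (c.1.1 i : ℕ))) then (1 : K) else 0) =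
      Matrix.reindex eR.symm eC.symm (Matrix.of fun (T : {Z : Finset {x : Fin k // x ∉ S} // Z.card = t})
        (U : {Z : Finset {x : Fin k // x ∉ S} // Z.card = t + 1}) => if T.1 ⊆ U.1 then (1 : K) else 0) := by
    ext r c
    simp only [Matrix.reindex_apply, Equiv.symm_symm, Matrix.submatrix_apply, Matrix.of_apply]
    refine if_congr ?_ rfl rfl
    rw [mem_colR_iff_zeros c.1.1 r.1.1 (r.2.trans c.2.symm), ← heR r, ← heC c, Finset.map_subset_map, Finset.card_map,
      Finset.card_map, (eR r).2, (eC c).2]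
    exact ⟨fun h => h.1, fun h => ⟨h, rfl⟩⟩
  rw [key, Matrix.rank_reindex, rank_incl_pow K (α := {x : Fin k // x ∉ S}) t 1, hα]

/-- an INFEASIBLE spectator set (`|S| > j` or `j − |S|` odd) has no rows at codegree `j`: block rank `0` -/
theorem rank_fiber_zero (K : Type*) [Field K] (k j : ℕ) (S : Finset (Fin k)) (h : ¬ (S.card ≤ j ∧ Even (j - S.card))) :
    (Matrix.of fun (r : {r : {v : Fin k → Fin 3 // (∑ i, (v i : ℕ)) + j = k * 2} // Finset.univ.filter (fun l => (r.1 l : ℕ) = 1) = S})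
        (c : {c : {m : Fin k → Fin 3 // (∑ i, (m i : ℕ)) + (j + 2) = k * 2} // Finset.univ.filter (fun l => (c.1 l : ℕ) = 1) = S}) =>
      if List.ofFn (fun i => (r.1.1 i : ℕ)) ∈ colR 4 (List.ofFn (fun i => (c.1.1 i : ℕ))) then (1 : K) else 0).rank = 0 := by
  haveI : IsEmpty {r : {v : Fin k → Fin 3 // (∑ i, (v i : ℕ)) + j = k * 2} // Finset.univ.filter (fun l => (r.1 l : ℕ) = 1) = S} :=
    ⟨fun r => h (by
      have h1 := sum_add_levels r.1.1
      rw [r.2] at h1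
      have h2 := r.1.2
      exact ⟨by omega, ⟨(Finset.univ.filter (fun l => (r.1.1 l : ℕ) = 0)).card, by omega⟩⟩)⟩
  have hle := Matrix.rank_le_card_height (Matrix.of fun
      (r : {r : {v : Fin k → Fin 3 // (∑ i, (v i : ℕ)) + j = k * 2} // Finset.univ.filter (fun l => (r.1 l : ℕ) = 1) = S})
      (c : {c : {m : Fin k → Fin 3 // (∑ i, (m i : ℕ)) + (j + 2) = k * 2} // Finset.univ.filter (fun l => (c.1 l : ℕ) = 1) = S}) =>
      if List.ofFn (fun i => (r.1.1 i : ℕ)) ∈ colR 4 (List.ofFn (fun i => (c.1.1 i : ℕ))) then (1 : K) else 0)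
  rw [Fintype.card_eq_zero] at hle
  omega

/-! ## THEOREM: `×q : B_{2k−j−2} → B_{2k−j}` at every codegree `j`, characteristic `0` -/

/-- **THEOREM L at `d = 4`, `c′ = 1`, every level** (`B = K[x₁,…,x_k]/(xᵢ³)`, `q = Σ xᵢ²`, `char K = 0`): in anchor 174's convention,
`rank (×q : B_{2k−j−2} → B_{2k−j}) = Σ_{s=0}^{k} C(k,s)·[s ≤ j ∧ 2 ∣ j − s]·min (C(k−s,(j−s)/2), C(k−s,(j−s)/2+1))`. -/
theorem rank_mulDelta_d4_levels (K : Type*) [Field K] [CharZero K] (k j : ℕ) :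
    (Matrix.of fun (v : {v : Fin k → Fin 3 // (∑ i, (v i : ℕ)) + j = k * 2})
        (m : {m : Fin k → Fin 3 // (∑ i, (m i : ℕ)) + (j + 2) = k * 2}) =>
      if List.ofFn (fun i => (v.1 i : ℕ)) ∈ colR 4 (List.ofFn (fun i => (m.1 i : ℕ))) then (1 : K) else 0).rank =
      ∑ s ∈ Finset.range (k + 1), k.choose s *
        (if s ≤ j ∧ Even (j - s) then min ((k - s).choose ((j - s) / 2)) ((k - s).choose ((j - s) / 2 + 1)) else 0) := by
  have hsum := rank_eq_sum_rank_fiber_of (K := K) (ι := Finset (Fin k))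
    (fun (v : {v : Fin k → Fin 3 // (∑ i, (v i : ℕ)) + j = k * 2}) (m : {m : Fin k → Fin 3 // (∑ i, (m i : ℕ)) + (j + 2) = k * 2}) =>
      if List.ofFn (fun i => (v.1 i : ℕ)) ∈ colR 4 (List.ofFn (fun i => (m.1 i : ℕ))) then (1 : K) else 0)
    (fun v => Finset.univ.filter (fun l => (v.1 l : ℕ) = 1)) (fun m => Finset.univ.filter (fun l => (m.1 l : ℕ) = 1))
    (fun v m hvm => if_neg (fun h => hvm (spec_eq_of_mem_colR m.1 v.1 h)))
  rw [hsum]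
  have hblock : ∀ S : Finset (Fin k),
      (Matrix.of fun (r : {r : {v : Fin k → Fin 3 // (∑ i, (v i : ℕ)) + j = k * 2} // Finset.univ.filter (fun l => (r.1 l : ℕ) = 1) = S})
          (c : {c : {m : Fin k → Fin 3 // (∑ i, (m i : ℕ)) + (j + 2) = k * 2} // Finset.univ.filter (fun l => (c.1 l : ℕ) = 1) = S}) =>
        if List.ofFn (fun i => (r.1.1 i : ℕ)) ∈ colR 4 (List.ofFn (fun i => (c.1.1 i : ℕ))) then (1 : K) else 0).rank =
      (if S.card ≤ j ∧ Even (j - S.card) then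
        min ((k - S.card).choose ((j - S.card) / 2)) ((k - S.card).choose ((j - S.card) / 2 + 1)) else 0) := by
    intro S
    by_cases h : S.card ≤ j ∧ Even (j - S.card)
    · rw [if_pos h]
      obtain ⟨hle, z, hz⟩ := h
      exact rank_fiber K k j S ((j - S.card) / 2) (by omega)
    · rw [if_neg h]
      exact rank_fiber_zero K k j S h
  trans ∑ S : Finset (Fin k), (fun s => if s ≤ j ∧ Even (j - s) then
      min ((k - s).choose ((j - s) / 2)) ((k - s).choose ((j - s) / 2 + 1)) else 0) S.card
  · exact Finset.sum_congr rfl (fun S _ => hblock S)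
  · rw [← Finset.powerset_univ, Finset.sum_powerset_apply_card (fun s => if s ≤ j ∧ Even (j - s) then
      min ((k - s).choose ((j - s) / 2)) ((k - s).choose ((j - s) / 2 + 1)) else 0)]
    simp only [Finset.card_univ, Fintype.card_fin, smul_eq_mul]

end Summit.HodgeConjecture.HodgeConjecture.HodgeLocus.Census.UnitColumnRankD4Levels
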